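import Mathlib
import Literature.NumberTheory.LFunctions.Zhang2022.Section4Eq412Wide
import Literature.NumberTheory.LFunctions.Zhang2022.Section4Lemma44Holds
import Literature.NumberTheory.LFunctions.Zhang2022.Section4Line48TildeZ
import Literature.NumberTheory.LFunctions.Zhang2022.Section4TildeZ
import Literature.NumberTheory.LFunctions.DirichletLFunctionZeroFreeRegion
import HarnessLib

/-!
# Zhang (2022), §4: Lemma 4.4 on the WIDER strip `Ω₃′ = {½ − 3α < σ < 1 + α}` HOLDS (by
# reflection), hence (4.10) on `Ω₃′`, the printed (4.12) and `Z22:§4.u049` on the FULL disc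
# `|w| < 2α` — GAP row G-L1t7-1 closed

Topic `Literature/NumberTheory/LFunctions/Zhang2022` (Landau–Siegel audit tree; verdict-neutral).
Y. Zhang, *Discrete mean estimates and the Landau–Siegel zero*, arXiv:2211.02515v1 (2022)
[Zhang2022LandauSiegel] — **an unrefereed manuscript under adjudication; nothing here asserts or
denies its Theorems 1–2 or anything about Landau–Siegel zeros.** ZHANG-L discharge lane (WP09,
seat zl-w09-p6), GAP row G-L1t7-1 [Z22 p.21, (4.10), tex L1139–L1145 (stated on
`Ω₃ = {½ − α < σ < 1 + α, |t − 2πt₀| < 𝓛₁ + 3}`) vs. p.22 tex L1227–L1229 (used on the disc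
`|w| < 2α` around `½ + iγ`) and p.23 tex L1269–L1272 (Lemma 4.7's circle)]. The row's wanted repair
— Lemma 4.4 and (4.10) on the wider strip `Ω₃′` — was typed as the CLAIMS `Skeleton.Lemma44Wide`,
`Skeleton.Eq410Wide` (`Section4Eq410Wide`, with the edge `eq410Wide_of`) and the consumer edges
`Section4.eq412_of_lemma44Wide`, `step4u049_of_eq410Wide`, `step4u048_of_lemma44Wide`
(`Section4Eq412Wide`); the analytic half (Lemma 4.4 on `Ω₃′`) stayed OPEN.

This file PROVES it, WITHOUT re-running the (4.8) contour argument at `Re w = −3α`: the printed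
Lemma 4.4 on `Ω₃` (tree theorem `Section4.lemma44_holds`) is REFLECTED across the critical line.
For `s ∈ Ω₃′` with `σ ≤ ½ − α` put `s′ = 1 − s̄ ∈ Ω₃`. The exact functional equation (4.4)
(`GammaFactor.LFunction_mul_LFunction_eq`) and the reflection principle `conj L(z̄,ψ) = L(z,ψ̄)`
(`DirichletZFR.conj_LFunction_conj`) give `L(s,ψ)L(s,ψχ) = Z̃(s,ψ)·conj(L(s′,ψ)L(s′,ψχ))`; for
real `χ`, `F(1−s,ψ̄) = conj F(s′,ψ)` and `conj F(1−s′,ψ̄) = F(s,ψ)` (`Section4.FpolyBar_eq_conj`);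
and the EXACT identity `Z̃(s,ψ)·conj Z̃(1−s̄,ψ) = 1` (proved here from the definition (2.2) of
`Z(s,θ)`: `|τ(θ)|² = k`, `Γ(z̄) = conj Γ(z)`) turn Lemma 4.4 at `s′` into
`L(s,ψ)L(s,ψχ) − F(s,ψ) − Z̃(s,ψ)F(1−s,ψ̄) = Z̃(s,ψ)·conj E(s′)`, `|E(s′)| ≤ C𝓛⁻¹⁷⁹`; finally
`|Z̃(s,ψ)| ≤ 2e^{6π+2}` for `½ − 3α < σ ≤ ½ − α`, `|t − 2πt₀| < 𝓛₁ + 3` by the height-uniform (4.5)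
(`Section4.norm_tildeZW_ray_le`: `|Z̃(s,ψ)| ≤ 2e^{2π+2}P^{1−2(σ+α)} ≤ 2e^{2π+2}P^{4α}`, `P^{α} = e^{π}`).

Theorems (no definitions, no new facts, nothing computational):

* `GammaFactor.Zfac_mul_conj_Zfac_one_sub_conj` — `Z(s,θ)·conj Z(1−s̄,θ) = 1` (primitive `θ`,
  `Im s ≠ 0`); `GammaFactor.tildeZ_mul_conj_tildeZ_one_sub_conj` — the same for `Z̃`;
* `Skeleton.LL_eq_tildeZW_mul_conj` — `L(s,ψ)L(s,ψχ) = Z̃(s,ψ)·conj(L(1−s̄,ψ)L(1−s̄,ψχ))`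
  (`ψ ∈ Ψ`, `χ` primitive, `D ≥ 3`, `Im s ≠ 0`);
* `Skeleton.norm_tildeZW_le_of_wide` — `|Z̃(s,ψ)| ≤ 2e^{6π+2}` on the reflected part of `Ω₃′`;
* **`Skeleton.lemma44Wide_holds : Lemma44Wide`**, `Skeleton.eq410Wide_holds : Eq410Wide`,
  **`Section4.eq412_holds : Eq412`** (`Z22:(4.12)` AS PRINTED, full disc `|w| < 2α`),
  **`Section4.step4u049_holds : Step4u049`** (`Z22:§4.u049` AS PRINTED, full disc),
  `Section4.step4u048_eventually : ∃ c₀, ∀ c′ > c₀, Step4u048 c′`.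

WHAT THIS IS NOT: any claim about Theorems 1–2 of the manuscript or about Landau–Siegel zeros;
Lemma 4.4 is an unconditional approximate functional equation for `L(s,ψ)L(s,ψχ)`.

## References

* Y. Zhang, arXiv:2211.02515v1 (2022), §2 (2.2)–(2.5) p.5, §4 (4.4)–(4.5) p.18, Lemma 4.4 p.19,
  (4.10) p.21, (4.12) p.22, Lemma 4.7 p.23. [cite: Zhang2022LandauSiegel, §4 Lemma 4.4, (4.10), (4.12)]
-/

noncomputable section

open Complex Real ComplexConjugate

/-! ## `Z(s,θ)·conj Z(1−s̄,θ) = 1` -/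

namespace Literature.NumberTheory.LFunctions.Zhang2022.GammaFactor

variable {k : ℕ} [NeZero k]

/-- `conj (x^w) = x^{w̄}` for a real base `x ≥ 0`. [folklore] -/
private theorem conj_ofReal_cpow {x : ℝ} (hx : 0 ≤ x) (w : ℂ) :
    conj ((x : ℂ) ^ w) = (x : ℂ) ^ conj w := by
  rw [Complex.cpow_conj _ _ (by rw [Complex.arg_ofReal_of_nonneg hx]; exact Real.pi_ne_zero.symm),
    Complex.conj_ofReal]

/-- `Γ(z) ≠ 0` off the real axis. [folklore] -/
private theorem Gamma_ne_zero_of_im_ne_zero {z : ℂ} (hz : z.im ≠ 0) : Complex.Gamma z ≠ 0 := by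
  refine Complex.Gamma_ne_zero fun m h => hz ?_
  rw [h]; simp

/-- `τ(θ)·conj τ(θ) = k` for a primitive `θ` mod `k` (`|τ(θ)|² = k`).
[cite: MontgomeryVaughan2007, Thm 9.7] -/
private theorem tau_mul_conj_tau {θ : DirichletCharacter ℂ k} (hθ : θ.IsPrimitive) :
    tau θ * conj (tau θ) = (k : ℂ) := by
  rw [Complex.mul_conj, Complex.normSq_eq_norm_sq, norm_tau hθ,
    Real.sq_sqrt (Nat.cast_nonneg k)]
  push_cast
  rfl

/-- **`Z(s,θ)·conj Z(1−s̄,θ) = 1`** for a primitive `θ` mod `k` and `Im s ≠ 0` — the exact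
reflection symmetry of the factor of the functional equation (2.2): from the printed definition
`Z(s,θ) = τ(θ)π^{s−1/2}k^{−s}Γ((1−s)/2)/Γ(s/2)` (even `θ`; `−iτ(θ)π^{s−1/2}k^{−s}Γ((2−s)/2)/Γ((1+s)/2)`
odd), `conj Γ(z) = Γ(z̄)` and `|τ(θ)|² = k`. [cite: Zhang2022LandauSiegel, §2 (2.2), (2.5)] -/
theorem Zfac_mul_conj_Zfac_one_sub_conj {θ : DirichletCharacter ℂ k} (hθ : θ.IsPrimitive) {s : ℂ}
    (hs : s.im ≠ 0) : Zfac θ s * conj (Zfac θ (1 - conj s)) = 1 := by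
  have hk0 : (k : ℂ) ≠ 0 := Nat.cast_ne_zero.mpr (NeZero.ne k)
  have hπ0 : (π : ℂ) ≠ 0 := Complex.ofReal_ne_zero.mpr Real.pi_ne_zero
  have hτ := tau_mul_conj_tau hθ
  -- conjugation through the elementary factors
  have hcπ : ∀ w : ℂ, conj ((π : ℂ) ^ w) = (π : ℂ) ^ conj w :=
    fun w => conj_ofReal_cpow Real.pi_pos.le w
  have hck : ∀ w : ℂ, conj ((k : ℂ) ^ w) = (k : ℂ) ^ conj w := fun w => by
    have := conj_ofReal_cpow (Nat.cast_nonneg k) w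
    simpa using this
  have hcΓ : ∀ w : ℂ, conj (Complex.Gamma w) = Complex.Gamma (conj w) :=
    fun w => (Complex.Gamma_conj w).symm
  -- the Gamma values involved do not vanish
  have hΓ1 : Complex.Gamma ((1 - s) / 2) ≠ 0 :=
    Gamma_ne_zero_of_im_ne_zero (by simp; exact hs)
  have hΓ2 : Complex.Gamma (s / 2) ≠ 0 :=
    Gamma_ne_zero_of_im_ne_zero (by simp; exact hs)
  have hΓ3 : Complex.Gamma ((2 - s) / 2) ≠ 0 :=
    Gamma_ne_zero_of_im_ne_zero (by simp; exact hs)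
  have hΓ4 : Complex.Gamma ((1 + s) / 2) ≠ 0 :=
    Gamma_ne_zero_of_im_ne_zero (by simp; exact hs)
  -- powers: `π^{s−1/2}·π^{1/2−s} = 1`, `k^{−s}·k^{s−1} = k⁻¹`
  have hπpow : (π : ℂ) ^ (s - 1 / 2) * (π : ℂ) ^ (1 / 2 - s) = 1 := by
    rw [← Complex.cpow_add _ _ hπ0, show s - 1 / 2 + (1 / 2 - s) = (0 : ℂ) by ring, Complex.cpow_zero]
  have hkpow : (k : ℂ) ^ (-s) * (k : ℂ) ^ (s - 1) = (k : ℂ)⁻¹ := by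
    rw [← Complex.cpow_add _ _ hk0, show -s + (s - 1) = (-1 : ℂ) by ring, Complex.cpow_neg_one]
  unfold Zfac
  split_ifs with hev
  · -- even `θ`
    simp only [map_mul, map_inv₀, hcπ, hck, hcΓ, map_sub, map_div₀, map_one, Complex.conj_conj,
      map_neg, map_ofNat]
    have e2 : (1 - (1 - s)) / 2 = s / 2 := by ring
    rw [e2]
    calc tau θ * (π : ℂ) ^ (s - 1 / 2) * (k : ℂ) ^ (-s) * Complex.Gamma ((1 - s) / 2) *
          (Complex.Gamma (s / 2))⁻¹ *
          (conj (tau θ) * (π : ℂ) ^ (1 - s - 1 / 2) * (k : ℂ) ^ (-(1 - s)) * Complex.Gamma (s / 2) *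
            (Complex.Gamma ((1 - s) / 2))⁻¹)
        = (tau θ * conj (tau θ)) * ((π : ℂ) ^ (s - 1 / 2) * (π : ℂ) ^ (1 / 2 - s)) *
            ((k : ℂ) ^ (-s) * (k : ℂ) ^ (s - 1)) *
            (Complex.Gamma ((1 - s) / 2) * (Complex.Gamma ((1 - s) / 2))⁻¹) *
            ((Complex.Gamma (s / 2))⁻¹ * Complex.Gamma (s / 2)) := by
          rw [show (1 : ℂ) - s - 1 / 2 = 1 / 2 - s by ring, show -((1 : ℂ) - s) = s - 1 by ring]
          ring
      _ = 1 := by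
          rw [hτ, hπpow, hkpow, mul_inv_cancel₀ hΓ1, inv_mul_cancel₀ hΓ2]
          field_simp
  · -- odd `θ`
    simp only [map_mul, map_inv₀, hcπ, hck, hcΓ, map_sub, map_div₀, map_one, Complex.conj_conj,
      map_neg, map_ofNat, Complex.conj_I, map_add]
    have e2 : (2 - (1 - s)) / 2 = (1 + s) / 2 := by ring
    have e3 : (1 + (1 - s)) / 2 = (2 - s) / 2 := by ring
    rw [e2, e3]
    calc -I * tau θ * (π : ℂ) ^ (s - 1 / 2) * (k : ℂ) ^ (-s) * Complex.Gamma ((2 - s) / 2) *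
          (Complex.Gamma ((1 + s) / 2))⁻¹ *
          (-(-I) * conj (tau θ) * (π : ℂ) ^ (1 - s - 1 / 2) * (k : ℂ) ^ (-(1 - s)) *
            Complex.Gamma ((1 + s) / 2) * (Complex.Gamma ((2 - s) / 2))⁻¹)
        = (-I * I) * (tau θ * conj (tau θ)) * ((π : ℂ) ^ (s - 1 / 2) * (π : ℂ) ^ (1 / 2 - s)) *
            ((k : ℂ) ^ (-s) * (k : ℂ) ^ (s - 1)) *
            (Complex.Gamma ((2 - s) / 2) * (Complex.Gamma ((2 - s) / 2))⁻¹) *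
            ((Complex.Gamma ((1 + s) / 2))⁻¹ * Complex.Gamma ((1 + s) / 2)) := by
          rw [show (1 : ℂ) - s - 1 / 2 = 1 / 2 - s by ring, show -((1 : ℂ) - s) = s - 1 by ring]
          ring
      _ = 1 := by
          rw [hτ, hπpow, hkpow, mul_inv_cancel₀ hΓ3, inv_mul_cancel₀ hΓ4,
            show -I * I = (1 : ℂ) by rw [neg_mul, Complex.I_mul_I, neg_neg]]
          field_simp

variable {k₁ k₂ : ℕ} [NeZero k₁] [NeZero k₂]

/-- **`Z̃(s,ψ)·conj Z̃(1−s̄,ψ) = 1`** (`Z̃ = Z(·,ψ)Z(·,ψχ)`, both characters primitive, `Im s ≠ 0`).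
[cite: Zhang2022LandauSiegel, §4 (4.4)] -/
theorem tildeZ_mul_conj_tildeZ_one_sub_conj {ψ : DirichletCharacter ℂ k₁}
    {θ₂ : DirichletCharacter ℂ k₂} (hψ : ψ.IsPrimitive) (hθ : θ₂.IsPrimitive) {s : ℂ}
    (hs : s.im ≠ 0) : tildeZ ψ θ₂ s * conj (tildeZ ψ θ₂ (1 - conj s)) = 1 := by
  rw [tildeZ_def, tildeZ_def, map_mul]
  calc Zfac ψ s * Zfac θ₂ s * (conj (Zfac ψ (1 - conj s)) * conj (Zfac θ₂ (1 - conj s)))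
      = (Zfac ψ s * conj (Zfac ψ (1 - conj s))) * (Zfac θ₂ s * conj (Zfac θ₂ (1 - conj s))) := by
        ring
    _ = 1 := by
        rw [Zfac_mul_conj_Zfac_one_sub_conj hψ hs, Zfac_mul_conj_Zfac_one_sub_conj hθ hs, one_mul]

end Literature.NumberTheory.LFunctions.Zhang2022.GammaFactor

/-! ## The reflection of `L(s,ψ)L(s,ψχ)` and Lemma 4.4 on `Ω₃′` -/

namespace Literature.NumberTheory.LFunctions.Zhang2022.Skeleton

open Literature.NumberTheory.LFunctions.Zhang2022.Section4

variable {D : ℕ} [NeZero D]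

/-- **`L(s,ψ)L(s,ψχ) = Z̃(s,ψ)·conj(L(1−s̄,ψ)L(1−s̄,ψχ))`** for `ψ ∈ Ψ`, `χ` primitive, `D ≥ 3`,
`Im s ≠ 0`: the exact functional equation (4.4) followed by the reflection principle
`L(1−s,ψ̄) = conj L(1−s̄,ψ)`. [cite: Zhang2022LandauSiegel, §4 (4.4)] -/
theorem LL_eq_tildeZW_mul_conj {χ : DirichletCharacter ℂ D} (hD : 3 ≤ D) (hχ : χ.IsPrimitive)
    (x : Chr D) {s : ℂ} (hs : s.im ≠ 0) :
    LL χ x s = tildeZW χ x s * conj (LL χ x (1 - conj s)) := by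
  have hprim : (psiChi χ x).IsPrimitive := psiChiPrimitive_holds D χ x hD hχ
  have hDp : D * x.p ≠ 1 :=
    (lt_of_lt_of_le (by omega : 1 < D) (Nat.le_mul_of_pos_right D x.prime.pos)).ne'
  have hψ1 : x.ψ ≠ 1 := x.ψ_ne_one
  have hθ1 : psiChi χ x ≠ 1 := GammaFactor.ne_one_of_isPrimitive hprim hDp
  have hfe := GammaFactor.LFunction_mul_LFunction_eq x.prim x.p_ne_one hprim hDp hs
  have h1 : x.ψ⁻¹.LFunction (1 - s) = conj (x.ψ.LFunction (1 - conj s)) := by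
    rw [← DirichletZFR.conj_LFunction_conj x.ψ hψ1 (1 - s), map_sub, map_one]
  have h2 : (psiChi χ x)⁻¹.LFunction (1 - s) = conj ((psiChi χ x).LFunction (1 - conj s)) := by
    rw [← DirichletZFR.conj_LFunction_conj (psiChi χ x) hθ1 (1 - s), map_sub, map_one]
  rw [LL, LL, tildeZW, hfe, h1, h2, map_mul]

omit [NeZero D] in
/-- Points of the window `|t − 2πt₀| < 𝓛₁ + 3` have positive height (`𝓛 ≥ 2`:
`2πt₀ − 𝓛₁ − 3 = 2π𝓛⁵¹⁹ − 𝓛⁴⁰⁵ − 3 > 0`). [cite: Zhang2022LandauSiegel, §2 (2.8)] -/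
theorem im_pos_of_window (hℓ : 2 ≤ ell D) {s : ℂ} (ht : |s.im - 2 * π * t0 D| < ell1 D + 3) :
    0 < s.im := by
  rw [t0, ell1] at ht
  obtain ⟨ht1, -⟩ := abs_lt.mp ht
  have h1 : (1 : ℝ) ≤ ell D := by linarith
  have h405 : ell D ^ 405 ≤ ell D ^ 519 := pow_le_pow_right₀ h1 (by norm_num)
  have h519 : (4 : ℝ) ≤ ell D ^ 519 := by
    have : (4 : ℝ) ≤ ell D ^ 2 := by nlinarith
    exact this.trans (pow_le_pow_right₀ h1 (by norm_num))
  have hπ3 : 3 * ell D ^ 519 ≤ π * ell D ^ 519 :=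
    mul_le_mul_of_nonneg_right Real.pi_gt_three.le (by positivity)
  linarith

/-- **`|Z̃(s,ψ)| ≤ 2e^{6π+2}` on the reflected part of `Ω₃′`**: for `𝓛 ≥ 4`, `D ≥ 3`, `χ` primitive,
`½ − 3α < σ ≤ ½ − α` and `|t − 2πt₀| < 𝓛₁ + 3` — the height-uniform (4.5)
(`Section4.norm_tildeZW_ray_le` at `s + α`, `v = 0`): `|Z̃(s)| ≤ 2e^{2π+2}P^{1−2(σ+α)}` and
`P^{1−2(σ+α)} ≤ P^{4α} = e^{4π}`. [cite: Zhang2022LandauSiegel, §4 (4.5)] -/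
theorem norm_tildeZW_le_of_wide {χ : DirichletCharacter ℂ D} (hℓ : 4 ≤ ell D) (hD3 : 3 ≤ D)
    (hχ : χ.IsPrimitive) (x : Chr D) {s : ℂ} (hσ1 : 1 / 2 - 3 * alpha D < s.re)
    (hσ2 : s.re ≤ 1 / 2 - alpha D) (ht : |s.im - 2 * π * t0 D| < ell1 D + 3) :
    ‖tildeZW χ x s‖ ≤ 2 * Real.exp (6 * π + 2) := by
  obtain ⟨hα0, hα8, -, hP1⟩ := alpha_facts_of_four_le_ell hℓ
  have hℓ0 : 0 < ell D := by linarith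
  -- apply the ray bound at `s + α` with `v = 0`
  set s₁ : ℂ := s + (alpha D : ℂ) with hs₁
  have hs₁re : s₁.re = s.re + alpha D := by simp [hs₁]
  have hs₁im : s₁.im = s.im := by simp [hs₁]
  have h1 : 1 / 2 - 3 * alpha D < s₁.re := by rw [hs₁re]; linarith
  have h2 : s₁.re < 1 + alpha D := by rw [hs₁re]; linarith
  have h3 : |s₁.im - 2 * π * t0 D| < ell1 D + 3 := by rw [hs₁im]; exact ht
  have hv : |(0 : ℝ)| ≤ ell D ^ 20 := by rw [abs_zero]; positivity
  have hray := norm_tildeZW_ray_le χ hℓ hD3 hχ x h1 h2 h3 hv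
  have hpt : s₁ + (((-alpha D : ℝ) : ℂ) + (0 : ℝ) * I) = s := by
    simp [hs₁]
  rw [hpt, hs₁re] at hray
  -- `P^{1 − 2(σ+α)} ≤ P^{4α} = e^{4π}`
  have hexp : 1 - 2 * (s.re + alpha D) ≤ 4 * alpha D := by linarith
  have hPpow : bigP D ^ (1 - 2 * (s.re + alpha D)) ≤ bigP D ^ (4 * alpha D) :=
    Real.rpow_le_rpow_of_exponent_le hP1 hexp
  have hP4 : bigP D ^ (4 * alpha D) = Real.exp (4 * π) := by
    rw [bigP, ← Real.exp_mul, alpha, bigP, Real.log_exp]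
    congr 1
    field_simp
  have hE : Real.exp (2 * π + 2) * Real.exp (4 * π) = Real.exp (6 * π + 2) := by
    rw [← Real.exp_add]; ring_nf
  calc ‖tildeZW χ x s‖ ≤ 2 * Real.exp (2 * π + 2) * bigP D ^ (1 - 2 * (s.re + alpha D)) := hray
    _ ≤ 2 * Real.exp (2 * π + 2) * bigP D ^ (4 * alpha D) := by gcongr
    _ = 2 * Real.exp (6 * π + 2) := by rw [hP4, mul_assoc, hE]

/-- `𝓛 ≥ M` once `D ≥ ⌈exp M⌉₊`. [cite: Zhang2022LandauSiegel, §2 (2.1)] -/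
private theorem le_ell_of_ceil_exp_le' {M : ℝ} {D : ℕ} (hD : ⌈Real.exp M⌉₊ ≤ D) : M ≤ ell D := by
  have hDexp : Real.exp M ≤ D := le_trans (Nat.le_ceil _) (by exact_mod_cast hD)
  have hDpos : (0 : ℝ) < D := lt_of_lt_of_le (Real.exp_pos _) hDexp
  rw [ell]; exact (Real.le_log_iff_exp_le hDpos).mpr hDexp

/-- **Lemma 4.4 on `Ω₃′ = {½ − 3α < σ < 1 + α, |t − 2πt₀| < 𝓛₁ + 3}` HOLDS** (the repair wanted by
GAP row G-L1t7-1): for `ψ ∈ Ψ₁` and `s ∈ Ω₃′`,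
`L(s,ψ)L(s,ψχ) = F(s,ψ) + Z̃(s,ψ)F(1−s,ψ̄) + O(𝓛⁻¹⁷⁹)`, constant `2e^{6π+2}·C₄₄`. For `σ > ½ − α`
this is the printed Lemma 4.4 (`Section4.lemma44_holds`); for `σ ≤ ½ − α` it is Lemma 4.4 at the
reflected point `s′ = 1 − s̄ ∈ Ω₃`, carried back by `L(s)L(s) = Z̃(s)·conj(L(s′)L(s′))`
(`LL_eq_tildeZW_mul_conj`), `F(1−s,ψ̄) = conj F(s′,ψ)`, `conj F(1−s′,ψ̄) = F(s,ψ)`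
(`Section4.FpolyBar_eq_conj`, real `χ`), `Z̃(s)·conj Z̃(s′) = 1`
(`GammaFactor.tildeZ_mul_conj_tildeZ_one_sub_conj`) and `|Z̃(s)| ≤ 2e^{6π+2}`
(`norm_tildeZW_le_of_wide`). Unconditional. [cite: Zhang2022LandauSiegel, §4 Lemma 4.4, (4.10)] -/
theorem lemma44Wide_holds : Lemma44Wide := by
  obtain ⟨C, D₀, hC⟩ := lemma44_holds
  refine ⟨2 * Real.exp (6 * π + 2) * max C 0, max D₀ (max 3 ⌈Real.exp 4⌉₊),
    fun D _ χ hD hq hp x hx s hs => ?_⟩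
  have hD₀ : D₀ ≤ D := le_trans (le_max_left _ _) hD
  have hD3 : 3 ≤ D := le_trans (le_trans (le_max_left _ _) (le_max_right _ _)) hD
  have hℓ4 : 4 ≤ ell D :=
    le_ell_of_ceil_exp_le' (le_trans (le_trans (le_max_right _ _) (le_max_right _ _)) hD)
  have h44 := hC D χ hD₀ hq hp
  obtain ⟨hα0, hα8, -, -⟩ := alpha_facts_of_four_le_ell hℓ4
  have hℓpos : 0 < ell D := by linarith
  have hK1 : (1 : ℝ) ≤ 2 * Real.exp (6 * π + 2) := by
    have := Real.one_le_exp (show (0 : ℝ) ≤ 6 * π + 2 by positivity)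
    linarith
  have hC0 : 0 ≤ max C 0 := le_max_right _ _
  have hinv : 0 ≤ (ell D ^ 179)⁻¹ := by positivity
  obtain ⟨hs1, hs2, hs3⟩ := hs
  by_cases hσ : 1 / 2 - alpha D < s.re
  · -- `s ∈ Ω₃`: the printed Lemma 4.4
    have hs' : s ∈ Omega3 D := ⟨hσ, hs2, hs3⟩
    calc ‖LL χ x s - Fpoly χ x s - tildeZW χ x s * FpolyBar χ x (1 - s)‖
        ≤ C * (ell D ^ 179)⁻¹ := h44 x hx s hs'
      _ ≤ max C 0 * (ell D ^ 179)⁻¹ := by gcongr; exact le_max_left _ _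
      _ = 1 * (max C 0 * (ell D ^ 179)⁻¹) := (one_mul _).symm
      _ ≤ 2 * Real.exp (6 * π + 2) * (max C 0 * (ell D ^ 179)⁻¹) := by gcongr
      _ = 2 * Real.exp (6 * π + 2) * max C 0 * (ell D ^ 179)⁻¹ := by ring
  · -- `σ ≤ ½ − α`: reflect to `s′ = 1 − s̄ ∈ Ω₃`
    have hσ : s.re ≤ 1 / 2 - alpha D := not_lt.mp hσ
    set s' : ℂ := 1 - conj s with hs'def
    have hs're : s'.re = 1 - s.re := by simp [hs'def]
    have hs'im : s'.im = s.im := by simp [hs'def]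
    have hs'mem : s' ∈ Omega3 D := by
      refine ⟨by rw [hs're]; linarith, by rw [hs're]; linarith, by rw [hs'im]; exact hs3⟩
    have hE := h44 x hx s' hs'mem
    have him : s.im ≠ 0 := (im_pos_of_window (by linarith) hs3).ne'
    -- the four identities
    have hLL := LL_eq_tildeZW_mul_conj hD3 hp x him
    have hF1 : FpolyBar χ x (1 - s) = conj (Fpoly χ x s') := by
      rw [FpolyBar_eq_conj hq x (1 - s), map_sub, map_one]
    have hconj : conj (1 - s') = s := by
      rw [hs'def, map_sub, map_one, map_sub, map_one, Complex.conj_conj, sub_sub_cancel]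
    have hF2 : conj (FpolyBar χ x (1 - s')) = Fpoly χ x s := by
      rw [FpolyBar_eq_conj hq x (1 - s'), Complex.conj_conj, hconj]
    have hZ : tildeZW χ x s * conj (tildeZW χ x s') = 1 :=
      GammaFactor.tildeZ_mul_conj_tildeZ_one_sub_conj x.prim (psiChiPrimitive_holds D χ x hD3 hp) him
    -- the reflected approximate functional equation
    have key : LL χ x s - Fpoly χ x s - tildeZW χ x s * FpolyBar χ x (1 - s)
        = tildeZW χ x s *
          conj (LL χ x s' - Fpoly χ x s' - tildeZW χ x s' * FpolyBar χ x (1 - s')) := by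
      rw [map_sub, map_sub, map_mul, hF2, hLL, hF1]
      linear_combination (Fpoly χ x s) * hZ
    have hZn := norm_tildeZW_le_of_wide hℓ4 hD3 hp x hs1 hσ hs3
    rw [key, norm_mul, Complex.norm_conj]
    calc ‖tildeZW χ x s‖ * ‖LL χ x s' - Fpoly χ x s' - tildeZW χ x s' * FpolyBar χ x (1 - s')‖
        ≤ (2 * Real.exp (6 * π + 2)) * (C * (ell D ^ 179)⁻¹) :=
          mul_le_mul hZn hE (norm_nonneg _) (by positivity)
      _ ≤ (2 * Real.exp (6 * π + 2)) * (max C 0 * (ell D ^ 179)⁻¹) := by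
          gcongr; exact le_max_left _ _
      _ = 2 * Real.exp (6 * π + 2) * max C 0 * (ell D ^ 179)⁻¹ := by ring

/-- `Lemma44Wide` — `_holds` alias of `lemma44Wide_holds` above under the fact's exact name (appended
2026-08-28, D-0026 bookkeeping: the proof term is the existing theorem of this file; no statement,
definition or attribute is edited; no new named fact; the ledger's debt table listed the fact
unproved). [cite: Zhang2022LandauSiegel, §4 Lemma 4.4, (4.10)] -/
theorem _root_.Literature.NumberTheory.LFunctions.Zhang2022.Skeleton.Lemma44Wide_holds :
    Lemma44Wide :=
  _root_.Literature.NumberTheory.LFunctions.Zhang2022.Skeleton.lemma44Wide_holds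

/-- **(4.10) on `Ω₃′` HOLDS** (GAP row G-L1t7-1's decl wanted `Eq410Wide`): the landed edge
`eq410Wide_of` (Lemmas 4.1, 4.2 — tree theorems `lemma41_holds`, `lemma42_holds` — and Lemma 4.4
on `Ω₃′`). Unconditional. [cite: Zhang2022LandauSiegel, §4 (4.10)] -/
theorem eq410Wide_holds : Eq410Wide := eq410Wide_of lemma41_holds lemma42_holds lemma44Wide_holds

/-- `Eq410Wide` — `_holds` alias of `eq410Wide_holds` above under the fact's exact name (appended
2026-08-28, D-0026 bookkeeping: the proof term is the existing theorem of this file; no statement,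
definition or attribute is edited; no new named fact; the ledger's debt table listed the fact
unproved). [cite: Zhang2022LandauSiegel, §4 (4.10)] -/
theorem _root_.Literature.NumberTheory.LFunctions.Zhang2022.Skeleton.Eq410Wide_holds : Eq410Wide :=
  _root_.Literature.NumberTheory.LFunctions.Zhang2022.Skeleton.eq410Wide_holds

end Literature.NumberTheory.LFunctions.Zhang2022.Skeleton

/-! ## The printed consumers: (4.12) and `Z22:§4.u049` on the full disc `|w| < 2α` -/

namespace Literature.NumberTheory.LFunctions.Zhang2022.Section4

open Literature.NumberTheory.LFunctions.Zhang2022.Skeleton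

/-- **(4.12) HOLDS AS PRINTED** (`Z22:(4.12)`, §4 p.22, tex L1227–L1239: for `ψ ∈ Ψ₁`, a
critical-line zero `ρ = ½ + iγ` of `𝒜(·,ψ)` with `|γ − 2πt₀| < 𝓛₁ + 2` and the FULL disc
`|w| < 2α`, "`𝒜(½ + iγ + w, ψ) = 1 − P^{−2w} + O(α𝓛)`"): the landed edge `eq412_of_lemma44Wide` on
`lemma44Wide_holds`. Unconditional. [cite: Zhang2022LandauSiegel, §4 (4.12) p.22] -/
theorem eq412_holds : Eq412 := eq412_of_lemma44Wide lemma44Wide_holds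

/-- `Eq412` — `_holds` alias of `eq412_holds` above under the fact's exact name (appended
2026-08-28, D-0026 bookkeeping: the proof term is the existing theorem of this file; no statement,
definition or attribute is edited; no new named fact; the ledger's debt table listed the fact
unproved). [cite: Zhang2022LandauSiegel, §4 (4.12) p.22] -/
theorem _root_.Literature.NumberTheory.LFunctions.Zhang2022.Section4.Eq412_holds : Eq412 :=
  _root_.Literature.NumberTheory.LFunctions.Zhang2022.Section4.eq412_holds

/-- **Display `Z22:§4.u049` HOLDS AS PRINTED** (§4 p.22, tex L1227–L1229: "Assume `|w| < 2α`. By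
(4.10), `𝒜(½+iγ+w) − (1 − P^{−2w}) = ℬ(½+iγ+w) + P^{−2w} + O(𝓛⁻¹⁰⁰)`" on the FULL disc): the
landed edge `step4u049_of_eq410Wide` on `eq410Wide_holds`. Unconditional.
[cite: Zhang2022LandauSiegel, §4 (4.12) (proof) p.22] -/
theorem step4u049_holds : Step4u049 := step4u049_of_eq410Wide eq410Wide_holds

/-- `Step4u049` — `_holds` alias of `step4u049_holds` above under the fact's exact name (appended
2026-08-28, D-0026 bookkeeping: the proof term is the existing theorem of this file; no statement,
definition or attribute is edited; no new named fact; the ledger's debt table listed the fact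
unproved). [cite: Zhang2022LandauSiegel, §4 (4.12) (proof) p.22] -/
theorem _root_.Literature.NumberTheory.LFunctions.Zhang2022.Section4.Step4u049_holds : Step4u049 :=
  _root_.Literature.NumberTheory.LFunctions.Zhang2022.Section4.step4u049_holds

/-- **`Z22:§4.u048` eventually in `c′`** (the Rouché inequality on the circle
`|w| = α(1 − c′α𝓛)`, full circle): the landed edge `step4u048_of_lemma44Wide` on
`lemma44Wide_holds`. Unconditional. [cite: Zhang2022LandauSiegel, Lemma 4.6 (proof) p.22] -/
theorem step4u048_eventually : ∃ c₀ : ℝ, ∀ c' : ℝ, c₀ < c' → Step4u048 c' :=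
  step4u048_of_lemma44Wide lemma44Wide_holds

end Literature.NumberTheory.LFunctions.Zhang2022.Section4

end
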